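import Summits.QuantumFields.BalabanUV.Beta.D1BFx.FineHessianWardKroneckerBlock
import Summits.QuantumFields.BalabanUV.Beta.D1BFx.SplitInstance
import Summits.QuantumFields.BalabanUV.Beta.D1BFx.AssemblyEnd
import Summits.QuantumFields.BalabanUV.Beta.D1BFx.RoadEnd

/-!
# Road BF-x, A7 END with K-R5's `hrow` + `hT1` retired in favour of first-bond divergence-freeness `hdiv`

A one-theorem twin of the owner's `D1BFx/AssemblyEnd.defect_le_at` (p221972): the SAME plug-in of the landed slot instances into
`Assembly.abs_defect_le_of_slots` at a fixed block size `n ≥ 2`, `Odd n`, for the two fine-loop pieces of record, with ONE change — slot (F)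
of the R-weighted gluon piece `TOfRed n a SbfBal (tableRed n Wbf)` is supplied by `FineHessianWardKroneckerBlock.hF_SbfBal_of_divFree`
(sub-row «D1-BFx-KRONECKER-BLOCK»), so the displayed analytic inputs `hrow` (Ward rows of `fineHess`) and `hT1` (its base-point-summed first
moments) become the single datum `hdiv : ∀ l' u' u, Σ_{κ'} (fineHess … κ' l' (u − e_{κ'}) u' − fineHess … κ' l' u u') = 0` — the same
datum road FP's END reads after leaf-02's «hT1-KRONECKER-WARD» (`FP/PerfectSandwichWard`), and the one leaf-01's N3-FINE-REL reduces to
letters.  §2 `d1Drift_BFx_of_divFree`: the same substitution carried through the owner's end-to-end theorem `RoadEndBFx.d1Drift_BFx` (p222356)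
— `D1Drift Lc Js N μ ν` from B1 + (K) + leg binder + slot-table sockets + `hdiv` + `hrowgh` + frozen-profile rows + (CONV)+(REST) + (U).
(K), (REST) (all words but the corner), (U), B1, `Spr (Ga n a)`, the ghost Ward rows `hrowgh` and `hdiv` itself stay OPEN hypotheses.

HONEST STATUS: assembly [folklore]; no cited facts; no `def`; 0 sorry; D1 NOT discharged; 0 wall binders; NOT BetaPertH, NOT continuum,
NOT Clay.  HONEST DEPENDENCY: continuum YM on T⁴ ⇐ BetaPertH ∧ nine spine estimates (0/9 proved); BetaPertH ⇐ (D1) ∧ (D4) ∧ CAP+tail;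
G-an2-4 gates asym, D1 and NE2/3/4.  Unit `b2b-balaban-gan24-formalise-leaf-05` (gen 31; cross-lane; STAGED for the owner's decision —
filed only on the owner's GO).
-/

open Finset Filter Topology
open scoped BigOperators
open Literature.MathematicalPhysics.QuantumFieldTheory.Balaban1983to89
open Literature.MathematicalPhysics.QuantumFieldTheory.Balaban1983to89.Beta
open WindowIdentification (fullSum psum)
open B12Sec2to5 (l1)
open DyadicShell (Pt toReal)
open ExpKernelCalculus (Site MKer BiLoc shiftK)
open SquareTable (stK)
open DressedMomentNormalisation (resSite)
open Summit.QuantumFields.BalabanUV.Beta.TameKernelCalculus (Spr Loc)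
open Summit.QuantumFields.BalabanUV.Beta.D1BFx.MomentTransferPeriodic (baseKer)
open Summit.QuantumFields.BalabanUV.Beta.D1BFx.GluonLeg (Ga)
open Summit.QuantumFields.BalabanUV.Beta.D1BFx.ReducedKernel (TableR TOfRed)
open Summit.QuantumFields.BalabanUV.Beta.D1BFx.DressedTadpoleTable (tableRed)
open Summit.QuantumFields.BalabanUV.Beta.D1BFx.ReducedKernelSandwich (fineHess)
open Summit.QuantumFields.BalabanUV.Beta.D1BFx.FineStencilBFBalaban (SbfBal)
open Summit.QuantumFields.BalabanUV.Beta.D1BFx.SecondStencilBF (Wbf)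
open Summit.QuantumFields.BalabanUV.Beta.D1BFx.GhostKernelComplete (PghQ fineHessGhQ)
open Summit.QuantumFields.BalabanUV.Beta.D1BFx.SplitInstance (RestIdx restK split_at_basePoint)
open Summit.QuantumFields.BalabanUV.Beta.D1BFx.Assembly (abs_defect_le_of_slots)
open Summit.QuantumFields.BalabanUV.Beta.D1BFx.AssemblySlots (conv_PghQ hF_PghQ_of_wardRows)
open Summit.QuantumFields.BalabanUV.Beta.D1BFx.AssemblySlotsBal (conv_SbfBal)
open Summit.QuantumFields.BalabanUV.Beta.D1BFx.FineHessianWardKroneckerBlock (hF_SbfBal_of_divFree)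

namespace Summit.QuantumFields.BalabanUV.Beta.D1BFx.AssemblyEndWard

/-! ## §1 The road's defect bound at one block size, `hrow` + `hT1` ↦ `hdiv` -/

section At

variable (n : ℕ) [NeZero n] (a cE cVH cΛ cR cK cQ cE₂ cJ4 cΛ₂ cR₂ cQ₂ x₀ ωgl ωgh lam N : ℝ) {WE WJ WΛ WR WQ : TableR}
  {CE CJ CΛ CRt CQ δW : ℝ} {gp : Pt → Pt → ℝ} {μ ν : Fin 4} {υ : Type*} [Fintype υ] {c : ℝ} {Ru CU : υ → ℝ} {CR : RestIdx → ℝ}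

/-- [folklore] **ROAD BF-x AT BLOCK SIZE `n` (`2 ≤ n`, `Odd n`) WITH K-R5's `hrow` + `hT1` RETIRED**: the owner's
`AssemblyEnd.defect_le_at` verbatim — `|c − Σ_{b ∈ image resSite} n⁻⁴·fullSum (stK μ ν N (gp b))| ≤ Σ_u CU u + Σ_τ CR τ` from (K), the leg
binder, the slot-table sockets, the ghost Ward rows, the frozen profile's bound and evenness, (CONV)+(REST) for the `RestIdx` words and (U) —
except that the gluon piece's two analytic inputs `hrow` (Ward rows) and `hT1` (base-point-summed first moments) are REPLACED by the single
datum `hdiv` (first-bond divergence-freeness of `fineHess n a SbfBal Wbf`), slot (F) of the gluon piece being taken from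
`FineHessianWardKroneckerBlock.hF_SbfBal_of_divFree` instead of `AssemblySlotsBal.hF_SbfBal`.  Nothing else differs. -/
theorem defect_le_at_of_divFree (hn : 2 ≤ n) (hodd : Odd n) (ha : 0 < a) (hμν : μ ≠ ν) (hGa : Spr (Ga n a))
    (hK : c = ωgl * B12Beta.secondMoment (TOfRed n a (SbfBal n a cE cVH cΛ cR cK cQ)
        (tableRed n (Wbf cE₂ cJ4 cΛ₂ cR₂ cQ₂ WE WJ WΛ WR WQ))) μ ν
      + ωgh * B12Beta.secondMoment (PghQ n a x₀ cK cQ) μ ν + ∑ u, Ru u)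
    (hω : ωgh * cK ^ 2 = -2 * (ωgl * cE ^ 2)) (hlam : ωgl * cE ^ 2 = 2 * N ^ 2 * lam)
    (hδW : 0 < δW)
    (hE : ∀ κ u l u', BiLoc (WE κ u l u') u u' CE δW) (hJ : ∀ κ u l u', BiLoc (WJ κ u l u') u u' CJ δW)
    (hΛ : ∀ κ u l u', BiLoc (WΛ κ u l u') u u' CΛ δW) (hR : ∀ κ u l u', BiLoc (WR κ u l u') u u' CRt δW)
    (hQ : ∀ κ u l u', BiLoc (WQ κ u l u') u u' CQ δW)
    (hEc : ∀ (κ : Fin 4) (u : Site 4) (l : Fin 4) (u' t : Site 4), WE κ (u + (n : ℤ) • t) l (u' + (n : ℤ) • t) = shiftK (-((n : ℤ) • t)) (WE κ u l u'))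
    (hJc : ∀ (κ : Fin 4) (u : Site 4) (l : Fin 4) (u' t : Site 4), WJ κ (u + (n : ℤ) • t) l (u' + (n : ℤ) • t) = shiftK (-((n : ℤ) • t)) (WJ κ u l u'))
    (hΛc : ∀ (κ : Fin 4) (u : Site 4) (l : Fin 4) (u' t : Site 4), WΛ κ (u + (n : ℤ) • t) l (u' + (n : ℤ) • t) = shiftK (-((n : ℤ) • t)) (WΛ κ u l u'))
    (hRc : ∀ (κ : Fin 4) (u : Site 4) (l : Fin 4) (u' t : Site 4), WR κ (u + (n : ℤ) • t) l (u' + (n : ℤ) • t) = shiftK (-((n : ℤ) • t)) (WR κ u l u'))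
    (hQc : ∀ (κ : Fin 4) (u : Site 4) (l : Fin 4) (u' t : Site 4), WQ κ (u + (n : ℤ) • t) l (u' + (n : ℤ) • t) = shiftK (-((n : ℤ) • t)) (WQ κ u l u'))
    (hEs : ∀ κ u l u', WE κ u l u' = WE l u' κ u) (hJs : ∀ κ u l u', WJ κ u l u' = WJ l u' κ u) (hΛs : ∀ κ u l u', WΛ κ u l u' = WΛ l u' κ u)
    (hRs : ∀ κ u l u', WR κ u l u' = WR l u' κ u) (hQs : ∀ κ u l u', WQ κ u l u' = WQ l u' κ u)
    (hdiv : ∀ (l' : Fin 4) (u' u : Site 4), ∑ κ' : Fin 4,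
      (fineHess n a (SbfBal n a cE cVH cΛ cR cK cQ) (Wbf cE₂ cJ4 cΛ₂ cR₂ cQ₂ WE WJ WΛ WR WQ) κ' l' (u - Pi.single κ' 1) u'
        - fineHess n a (SbfBal n a cE cVH cΛ cR cK cQ) (Wbf cE₂ cJ4 cΛ₂ cR₂ cQ₂ WE WJ WΛ WR WQ) κ' l' u u') = 0)
    (hrowgh : ∀ (κ' l' : Fin 4) (b : Site 4), HasSum (fineHessGhQ n a x₀ cK cQ κ' l' b) 0)
    (hg : ∀ b : Pt, ∃ C δ : ℝ, 0 < δ ∧ ∀ v, |gp b v| ≤ C * Real.exp (-δ * l1 v)) (hgev : ∀ b w : Pt, gp b (-w) = gp b w)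
    (hKr : ∀ τ : RestIdx, ∀ b ∈ (univ : Finset (Fin 4 → Fin n)).image resSite, ∃ B, Tendsto (psum (fun w : Pt =>
      restK n a (gp b) cE cΛ cR cK cQ cE₂ cJ4 cΛ₂ cR₂ cQ₂ x₀ WE WJ WΛ WR WQ ωgl ωgh lam N μ ν b τ w)) atTop (𝓝 B))
    (hRest : ∀ τ : RestIdx, |∑ b ∈ (univ : Finset (Fin 4 → Fin n)).image resSite, ((n : ℝ) ^ 4)⁻¹ * fullSum (fun w : Pt =>
      restK n a (gp b) cE cΛ cR cK cQ cE₂ cJ4 cΛ₂ cR₂ cQ₂ x₀ WE WJ WΛ WR WQ ωgl ωgh lam N μ ν b τ w)| ≤ CR τ)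
    (hU : ∀ u, |Ru u| ≤ CU u) :
    |c - ∑ b ∈ (univ : Finset (Fin 4 → Fin n)).image resSite, ((n : ℝ) ^ 4)⁻¹ * fullSum (stK μ ν N (gp b))|
      ≤ (∑ u, CU u) + ∑ τ, CR τ := by
  have h1 : 1 ≤ n := le_trans one_le_two hn
  have hEl : ∀ κ u l u', Loc (WE κ u l u') := fun κ u l u' => ⟨u, u', CE, δW, hδW, hE κ u l u'⟩
  have hJl : ∀ κ u l u', Loc (WJ κ u l u') := fun κ u l u' => ⟨u, u', CJ, δW, hδW, hJ κ u l u'⟩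
  have hΛl : ∀ κ u l u', Loc (WΛ κ u l u') := fun κ u l u' => ⟨u, u', CΛ, δW, hδW, hΛ κ u l u'⟩
  have hRl : ∀ κ u l u', Loc (WR κ u l u') := fun κ u l u' => ⟨u, u', CRt, δW, hδW, hR κ u l u'⟩
  have hQl : ∀ κ u l u', Loc (WQ κ u l u') := fun κ u l u' => ⟨u, u', CQ, δW, hδW, hQ κ u l u'⟩
  refine abs_defect_le_of_slots (ι := Fin 2) (T := RestIdx) (υ := υ) (μ := μ) (ν := ν) (N := N) (CU := CU) (CR := CR)
    (c := fun _ => c) (Bset := fun _ => (univ : Finset (Fin 4 → Fin n)).image resSite) (wt := fun _ _ => ((n : ℝ) ^ 4)⁻¹)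
    (Gf := fun _ => gp)
    (P := fun i _ => if i = 0 then TOfRed n a (SbfBal n a cE cVH cΛ cR cK cQ) (tableRed n (Wbf cE₂ cJ4 cΛ₂ cR₂ cQ₂ WE WJ WΛ WR WQ))
      else PghQ n a x₀ cK cQ)
    (ω := fun i _ => if i = 0 then ωgl else ωgh) (R := fun u _ => Ru u)
    (Kf := fun i _ b w => if i = 0 then ((n : ℝ) ^ 8)⁻¹ * (toReal w μ * toReal w ν *
        baseKer (fineHess n a (SbfBal n a cE cVH cΛ cR cK cQ) (Wbf cE₂ cJ4 cΛ₂ cR₂ cQ₂ WE WJ WΛ WR WQ) μ ν) b w)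
      else ((n : ℝ) ^ 8)⁻¹ * (toReal w μ * toReal w ν * baseKer (fineHessGhQ n a x₀ cK cQ μ ν) b w))
    (Kr := fun τ _ b w => restK n a (gp b) cE cΛ cR cK cQ cE₂ cJ4 cΛ₂ cR₂ cQ₂ x₀ WE WJ WΛ WR WQ ωgl ωgh lam N μ ν b τ w)
    ?_ ?_ ?_ ?_ ?_ ?_ ?_ n hn
  · -- (K)
    intro _ _
    rw [Fin.sum_univ_two]
    simp only [Fin.isValue, if_true, one_ne_zero, if_false]
    exact hK
  · -- (F)
    intro i _ _
    fin_cases i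
    · simp only [Fin.zero_eta, Fin.isValue, if_true]
      exact hF_SbfBal_of_divFree n a cE cVH cΛ cR cK cQ cE₂ cJ4 cΛ₂ cR₂ cQ₂ h1 ha hGa hδW hE hJ hΛ hR hQ hEc hJc hΛc hRc hQc hEs hJs
        hΛs hRs hQs hdiv μ ν
    · simp only [Fin.mk_one, Fin.isValue, one_ne_zero, if_false]
      exact hF_PghQ_of_wardRows n a x₀ cK cQ ha hodd hrowgh μ ν
  · -- (CONV) fine pieces
    intro i _ _
    fin_cases i
    · simp only [Fin.zero_eta, Fin.isValue, if_true]
      exact conv_SbfBal n a cE cVH cΛ cR cK cQ cE₂ cJ4 cΛ₂ cR₂ cQ₂ ha hGa hδW hE hJ hΛ hR hQ μ ν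
    · simp only [Fin.mk_one, Fin.isValue, one_ne_zero, if_false]
      exact conv_PghQ n a x₀ cK cQ ha μ ν
  · -- (CONV) rest words
    intro τ _ _ b hb
    exact hKr τ b hb
  · -- (SPLIT)
    intro _ _ b _ w
    rw [Fin.sum_univ_two]
    simp only [Fin.isValue, if_true, one_ne_zero, if_false]
    obtain ⟨C, δ, hδ, hgb⟩ := hg b
    exact split_at_basePoint n a cE cVH cΛ cR cK cQ cE₂ cJ4 cΛ₂ cR₂ cQ₂ x₀ WE WJ WΛ WR WQ ha hGa hδ hgb (hgev b) hEl hJl hΛl hRl hQl hμν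
      hω hlam b w
  · -- (U)
    intro u _ _
    exact hU u
  · -- (REST)
    intro τ _ _
    exact hRest τ

end At

/-! ## §2 The road end to end, `hrow` + `hT1` ↦ `hdiv` -/

section EndToEnd

open OneStepResolventKernel (JetData)
open OneStepKernelFamily (TbalOf D1Drift)
open DyadicShell (supNorm)
open GhostTable (gFree)
open BubbleTransfer (unitVec)
open Summit.QuantumFields.BalabanUV.Beta.D1BFx.Assembly (sum_uniform_resSite)
open Summit.QuantumFields.BalabanUV.Beta.D1BFx.AssemblyEnd (hT_of_pointwise)
open Summit.QuantumFields.BalabanUV.Beta.D1BFx.RoadEnd (d1Drift_of_strongRoad)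


variable {Lc : ℕ} [NeZero Lc] {a N : ℝ} {μ ν : Fin 4} {υ : Type*} [Fintype υ]
  {cE cVH cΛ cR cK cQ cE₂ cJ4 cΛ₂ cR₂ cQ₂ x₀ ωgl ωgh lam : ℕ → ℝ} {WE WJ WΛ WR WQ : ℕ → TableR} {CE CJ CΛ CRt CQ δW : ℕ → ℝ}
  {gp : ℕ → Pt → Pt → ℝ} {Ru : υ → ℕ → ℝ} {CU : υ → ℝ} {CR : RestIdx → ℝ} {D A : ℕ → ℝ} {δ U₁ : ℝ}

/-- [folklore] **ROAD BF-x, END TO END, WITH K-R5's `hrow` + `hT1` RETIRED** — the owner's `RoadEndBFx.d1Drift_BFx` (p222356) VERBATIM except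
that the two binders `hrow`∕`hT1` (Ward rows ∕ base-point-summed first moments of the gluon fine kernel at every odd `n ≥ 2`) are REPLACED by
the single datum `hdiv` (its first-bond divergence-freeness at every `n ≥ 2`), consumed through `defect_le_at_of_divFree`.  Conclusion, every
other binder and the composition (`RoadEnd.d1Drift_of_strongRoad` ∘ `AssemblyEnd.hT_of_pointwise`) unchanged. -/
theorem d1Drift_BFx_of_divFree (Js : ℕ → JetData 3 Lc) (hμν : μ ≠ ν) (hN : N ≠ 0) (hL : 2 ≤ Lc) (hodd : Odd Lc) (ha : 0 < a) (c : ℕ → ℝ)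
    (hD : ∀ j, 0 ≤ D j) (hA : ∀ j, 0 ≤ A j) (hδ : 0 < δ)
    -- the frozen profile: an3's six graded scalar rows, exponential bound, evenness
    (h0 : ∀ n : ℕ, 2 ≤ n → ∀ b ∈ (univ : Finset (Fin 4 → Fin n)).image resSite, ∀ v, |gp n b v - gFree v| ≤ D 0 / (n : ℝ) ^ 2)
    (h1 : ∀ n : ℕ, 2 ≤ n → ∀ b ∈ (univ : Finset (Fin 4 → Fin n)).image resSite, ∀ v (ρ : Fin 4),
      |(gp n b (v + unitVec ρ) - gFree (v + unitVec ρ)) - (gp n b v - gFree v)| ≤ D 1 / (n : ℝ) ^ 3)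
    (h2 : ∀ n : ℕ, 2 ≤ n → ∀ b ∈ (univ : Finset (Fin 4 → Fin n)).image resSite, ∀ v,
      |(gp n b (v + unitVec ν + unitVec μ) - gFree (v + unitVec ν + unitVec μ)) - (gp n b (v + unitVec ν) - gFree (v + unitVec ν)) -
          (gp n b (v + unitVec μ) - gFree (v + unitVec μ)) + (gp n b v - gFree v)| ≤ D 2 / (n : ℝ) ^ 4)
    (d0 : ∀ n : ℕ, 2 ≤ n → ∀ b ∈ (univ : Finset (Fin 4 → Fin n)).image resSite, ∀ v : Pt, v ≠ 0 →
      |gp n b v| ≤ A 0 * Real.exp (-(δ / n) * supNorm v) / (supNorm v : ℝ) ^ 2)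
    (d1 : ∀ n : ℕ, 2 ≤ n → ∀ b ∈ (univ : Finset (Fin 4 → Fin n)).image resSite, ∀ v : Pt, v ≠ 0 → ∀ ρ : Fin 4,
      |gp n b (v + unitVec ρ) - gp n b v| ≤ A 1 * Real.exp (-(δ / n) * supNorm v) / (supNorm v : ℝ) ^ 3)
    (d2 : ∀ n : ℕ, 2 ≤ n → ∀ b ∈ (univ : Finset (Fin 4 → Fin n)).image resSite, ∀ v : Pt, v ≠ 0 →
      |gp n b (v + unitVec ν + unitVec μ) - gp n b (v + unitVec ν) - gp n b (v + unitVec μ) + gp n b v| ≤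
        A 2 * Real.exp (-(δ / n) * supNorm v) / (supNorm v : ℝ) ^ 4)
    (hg : ∀ n : ℕ, 2 ≤ n → ∀ b : Pt, ∃ C δ' : ℝ, 0 < δ' ∧ ∀ v, |gp n b v| ≤ C * Real.exp (-δ' * l1 v))
    (hgev : ∀ n : ℕ, 2 ≤ n → ∀ b w : Pt, gp n b (-w) = gp n b w)
    -- bridge B1
    (hB1 : ∀ m : ℕ, 1 ≤ m → |(∑ j ∈ range m, B12Beta.secondMoment (TbalOf Lc Js j) μ ν) - c (Lc ^ m)| ≤ U₁)
    -- slot (K) with the loop-weight ratio and normalisation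
    (hGa : ∀ n : ℕ, 2 ≤ n → ∀ [NeZero n], Spr (Ga n a))
    (hK : ∀ n : ℕ, 2 ≤ n → Odd n → ∀ [NeZero n], c n =
      ωgl n * B12Beta.secondMoment (TOfRed n a (SbfBal n a (cE n) (cVH n) (cΛ n) (cR n) (cK n) (cQ n))
        (tableRed n (Wbf (cE₂ n) (cJ4 n) (cΛ₂ n) (cR₂ n) (cQ₂ n) (WE n) (WJ n) (WΛ n) (WR n) (WQ n)))) μ ν
      + ωgh n * B12Beta.secondMoment (PghQ n a (x₀ n) (cK n) (cQ n)) μ ν + ∑ u, Ru u n)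
    (hω : ∀ n : ℕ, 2 ≤ n → ωgh n * cK n ^ 2 = -2 * (ωgl n * cE n ^ 2)) (hlam : ∀ n : ℕ, 2 ≤ n → ωgl n * cE n ^ 2 = 2 * N ^ 2 * lam n)
    -- slot-table sockets
    (hδW : ∀ n, 0 < δW n)
    (hE : ∀ n κ u l u', BiLoc (WE n κ u l u') u u' (CE n) (δW n)) (hJ : ∀ n κ u l u', BiLoc (WJ n κ u l u') u u' (CJ n) (δW n))
    (hΛ : ∀ n κ u l u', BiLoc (WΛ n κ u l u') u u' (CΛ n) (δW n)) (hR : ∀ n κ u l u', BiLoc (WR n κ u l u') u u' (CRt n) (δW n))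
    (hQ : ∀ n κ u l u', BiLoc (WQ n κ u l u') u u' (CQ n) (δW n))
    (hEc : ∀ (n : ℕ) (κ : Fin 4) (u : Site 4) (l : Fin 4) (u' t : Site 4),
      WE n κ (u + (n : ℤ) • t) l (u' + (n : ℤ) • t) = shiftK (-((n : ℤ) • t)) (WE n κ u l u'))
    (hJc : ∀ (n : ℕ) (κ : Fin 4) (u : Site 4) (l : Fin 4) (u' t : Site 4),
      WJ n κ (u + (n : ℤ) • t) l (u' + (n : ℤ) • t) = shiftK (-((n : ℤ) • t)) (WJ n κ u l u'))
    (hΛc : ∀ (n : ℕ) (κ : Fin 4) (u : Site 4) (l : Fin 4) (u' t : Site 4),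
      WΛ n κ (u + (n : ℤ) • t) l (u' + (n : ℤ) • t) = shiftK (-((n : ℤ) • t)) (WΛ n κ u l u'))
    (hRc : ∀ (n : ℕ) (κ : Fin 4) (u : Site 4) (l : Fin 4) (u' t : Site 4),
      WR n κ (u + (n : ℤ) • t) l (u' + (n : ℤ) • t) = shiftK (-((n : ℤ) • t)) (WR n κ u l u'))
    (hQc : ∀ (n : ℕ) (κ : Fin 4) (u : Site 4) (l : Fin 4) (u' t : Site 4),
      WQ n κ (u + (n : ℤ) • t) l (u' + (n : ℤ) • t) = shiftK (-((n : ℤ) • t)) (WQ n κ u l u'))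
    (hEs : ∀ n κ u l u', WE n κ u l u' = WE n l u' κ u) (hJs : ∀ n κ u l u', WJ n κ u l u' = WJ n l u' κ u)
    (hΛs : ∀ n κ u l u', WΛ n κ u l u' = WΛ n l u' κ u) (hRs : ∀ n κ u l u', WR n κ u l u' = WR n l u' κ u)
    (hQs : ∀ n κ u l u', WQ n κ u l u' = WQ n l u' κ u)
    -- first-bond divergence-freeness of the gluon fine kernel (K-R5's `hrow` + `hT1` retired) and the ghost Ward rows
    (hdiv : ∀ n : ℕ, 2 ≤ n → ∀ [NeZero n], ∀ (l' : Fin 4) (u' u : Site 4), ∑ κ' : Fin 4,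
      (fineHess n a (SbfBal n a (cE n) (cVH n) (cΛ n) (cR n) (cK n) (cQ n))
          (Wbf (cE₂ n) (cJ4 n) (cΛ₂ n) (cR₂ n) (cQ₂ n) (WE n) (WJ n) (WΛ n) (WR n) (WQ n)) κ' l' (u - Pi.single κ' 1) u'
        - fineHess n a (SbfBal n a (cE n) (cVH n) (cΛ n) (cR n) (cK n) (cQ n))
          (Wbf (cE₂ n) (cJ4 n) (cΛ₂ n) (cR₂ n) (cQ₂ n) (WE n) (WJ n) (WΛ n) (WR n) (WQ n)) κ' l' u u') = 0)
    (hrowgh : ∀ n : ℕ, 2 ≤ n → ∀ [NeZero n], ∀ (κ' l' : Fin 4) (b : Site 4), HasSum (fineHessGhQ n a (x₀ n) (cK n) (cQ n) κ' l' b) 0)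
    -- (CONV) + (REST) for the rest words, (U)
    (hKr : ∀ n : ℕ, 2 ≤ n → ∀ [NeZero n], ∀ τ : RestIdx, ∀ b ∈ (univ : Finset (Fin 4 → Fin n)).image resSite, ∃ B,
      Tendsto (psum (fun w : Pt => restK n a (gp n b) (cE n) (cΛ n) (cR n) (cK n) (cQ n) (cE₂ n) (cJ4 n) (cΛ₂ n) (cR₂ n) (cQ₂ n) (x₀ n)
        (WE n) (WJ n) (WΛ n) (WR n) (WQ n) (ωgl n) (ωgh n) (lam n) N μ ν b τ w)) atTop (𝓝 B))
    (hRest : ∀ n : ℕ, 2 ≤ n → ∀ [NeZero n], ∀ τ : RestIdx, |∑ b ∈ (univ : Finset (Fin 4 → Fin n)).image resSite, ((n : ℝ) ^ 4)⁻¹ *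
      fullSum (fun w : Pt => restK n a (gp n b) (cE n) (cΛ n) (cR n) (cK n) (cQ n) (cE₂ n) (cJ4 n) (cΛ₂ n) (cR₂ n) (cQ₂ n) (x₀ n)
        (WE n) (WJ n) (WΛ n) (WR n) (WQ n) (ωgl n) (ωgh n) (lam n) N μ ν b τ w)| ≤ CR τ)
    (hU : ∀ n : ℕ, 2 ≤ n → ∀ u, |Ru u n| ≤ CU u) :
    D1Drift Lc Js N μ ν := by
  refine d1Drift_of_strongRoad Js hμν hN hL c (Bset := fun n => (univ : Finset (Fin 4 → Fin n)).image resSite)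
    (wt := fun n _ => ((n : ℝ) ^ 4)⁻¹) (Gf := gp) (U₂ := (∑ u, CU u) + ∑ τ, CR τ) hD hA hδ (fun n _ _ _ => by positivity)
    (fun n hn => sum_uniform_resSite (by omega)) h0 h1 h2 d0 d1 d2 hB1 ?_
  refine hT_of_pointwise (c := c)
    (F := fun n => ∑ b ∈ (univ : Finset (Fin 4 → Fin n)).image resSite, ((n : ℝ) ^ 4)⁻¹ * fullSum (stK μ ν N (gp n b)))
    (U := (∑ u, CU u) + ∑ τ, CR τ) (fun n hn hon => ?_) hL hodd
  haveI : NeZero n := ⟨by omega⟩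
  exact defect_le_at_of_divFree n a (cE n) (cVH n) (cΛ n) (cR n) (cK n) (cQ n) (cE₂ n) (cJ4 n) (cΛ₂ n) (cR₂ n) (cQ₂ n) (x₀ n) (ωgl n) (ωgh n) (lam n) N
    hn hon ha hμν (hGa n hn) (hK n hn hon) (hω n hn) (hlam n hn) (hδW n) (hE n) (hJ n) (hΛ n) (hR n) (hQ n) (hEc n) (hJc n) (hΛc n)
    (hRc n) (hQc n) (hEs n) (hJs n) (hΛs n) (hRs n) (hQs n) (hdiv n hn) (hrowgh n hn) (hg n hn) (hgev n hn) (hKr n hn)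
    (hRest n hn) (hU n hn)


end EndToEnd

end Summit.QuantumFields.BalabanUV.Beta.D1BFx.AssemblyEndWard
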